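import Summits.QuantumAdvantage.QuantumAdvantage.Theorems.GapDialSlice

/-!
# GapDial (2/4) — THE FEEDBACK PLANTING: the cubic-ANF sign problem with promise gap `2^{-n/2}` is `MOD₃`-hard for `AC⁰[p]`, `p ≠ 3`

For a `K × K` matrix `M` over `𝔽₂`, a readout `b` and a source `a`, the pair `F = x₁ᵀ M x₂ ⊕ x₂(b)` (`FF`, a cube-free `blTable`) and
`G = 1 ⊕ ⟨y₁,y₂⟩ ⊕ y₂(a)` (`GG`) on `K + K` variables has
`Φ(F,G) = -2^{-K} · Σ_{x : (I+M)x = e_a} (-1)^{x(b)}` (`fsum_feedback`, `value_feedback`): the `y`-sum of the bent table is a point mass, the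
`x₁`-sum forces the FEEDBACK EQUATION `(I + M) x₂ = e_a` — valid for ANY `M`.  With `M = E_w` (`EE`), the edge matrix of the width-3
counter automaton of `w ∈ {0,1}^m` (`K = kk m = 3(m+1)`; landed `Theorems.HintDialAutomaton`), `I + M = N_w` is unipotent, the unique
solution is the counter run (`mv_QQ_eq_sgl_iff`, `sum_solutions_EE`) and reading `b₀ = (last, 0)` gives
`value_qinst : Φ(qinst w) = -2^{-kk m} · (-1)^{[3 ∣ |w|]}` (`nsolve_single_origin_last`).  The code of `qinst w` is a literal projection of
`w` of polynomial length (`isProj_encode_qinst`, `length_encode_qinst_le`), hence the PLANTING THEOREM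
`gapSlice_not_mem_AC0Mod_of_small : (∀ m, δ (2·kk m) ≤ 2^{-kk m}) → GapSlice δ ∉ promiseLift (AC0Mod p)` for every prime `p ≠ 3`
(closure tool of `Theorems.HintDialClosure` + Smolensky), and `gapSlice_not_mem_of_small` (`p = 2`).  [this lineage g9; Smolensky 1987]
-/

set_option linter.dupNamespace false

noncomputable section


namespace Summit.QuantumAdvantage.QuantumAdvantage.Theorems.GapDial

open Finset
open Literature.Computability.Complexity
open Literature.Computability.QuantumComplexity
open Literature.Computability.MetaComplexity
open _root_.Computability (encodeNat)
open Summit.QuantumAdvantage.QuantumAdvantage.Theorems.HintDial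

set_option linter.unusedVariables false
set_option linter.unusedSectionVars false

/-! ## §4 ★★ THE FEEDBACK PLANTING: gaps `2^{-n/2}` and (diluted) `2^{-√n}` are `MOD₃`-hard for `AC⁰[⊕]` — with BOTH tables
given in full, the second one CONSTANT

`F_w(x′,x″) = ⟨x′, E_w x″⟩ ⊕ x″_{b₀}` (`E_w` = g6's nilpotent edge matrix, `N_w = I + E_w`), `G(y′,y″) = 1 ⊕ ⟨y′,y″⟩ ⊕ y″_{a₀}`.
`Σ_{x,y} (-1)^{F_w(x) + x·y + G(y)}`:  the `x′`-sum forces `y′ = E_w x″`; the `y″`-sum then forces `x″ ⊕ y′ = e_{a₀}`, i.e.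
`N_w x″ = e_{a₀}`, `x″ = x* := N_w⁻¹ e_{a₀}` (the counter run); what is left is `-2^{2k}(-1)^{x*_{b₀}}` and
`x*_{b₀} = [MOD₃(w) = 0]` (`nsolve_single_origin_last`).  Hence `Φ(F_w,G) = +2^{-k}` iff `MOD₃(w) = 0`, `-2^{-k}` otherwise. -/

namespace Automaton

open CubicForm (bit)
open BuzetChailloux (bxor zeroVec)
open Summit.QuantumAdvantage.QuantumAdvantage.Theorems.HintDial.Automaton

variable {m : ℕ} (w : Fin m → Bool)


/-- GapDial helper `bd_zero_left` (lens-3 g9 GapDial THEOREMS package; see the enclosing section docstring). -/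
theorem bd_zero_left {k : ℕ} (x : Fin k → Bool) : bd (fun _ => false) x = false :=
  bit_injective (by rw [bit_bd]; simp)

/-- GapDial helper `signOf_apply_eq_twist_sgl` (lens-3 g9 GapDial THEOREMS package; see the enclosing section docstring). -/
theorem signOf_apply_eq_twist_sgl {k : ℕ} (a : Fin k) (y : Fin k → Bool) : signOf (y a) = twist (sgl a) y := by
  rw [← bd_sgl_left a y, signOf_bd]

/-- `E_w` (the nilpotent edge matrix of the layered mod-3 automaton) in coordinates: every entry a literal of `w`. -/
def EE (a b : Fin (kk m)) : Bool := edgeB w (nd.symm a) (nd.symm b)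

/-- `x″ ⊕ E_w x″ = N_w x″`. -/
theorem bxor_mv_EE (x₂ : Fin (kk m) → Bool) : bxor x₂ (mv (EE w) x₂) = mv (QQ w) x₂ := by
  funext a
  show xor (x₂ a) (bd (EE w a) x₂) = bd (QQ w a) x₂
  apply bit_injective
  rw [bit_xor, bit_bd, bit_bd]
  simp only [QQ, EE, qEnt, bit_xor, add_mul, sum_add_distrib, EmbeddingLike.apply_eq_iff_eq]
  rw [sum_bit_decide_eq_mul]

/-- the counter run `x* = N_w⁻¹ e_{a₀}` in coordinates, -/
def xstar : Fin (kk m) → Bool := ofNV (nsolve w (single (((0 : Fin (m + 1)), (0 : Fin 3)) : Nd m)))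

/-- whose `b₀`-entry is `MOD₃(w)` (g6, `nsolve_single_origin_last`), -/
theorem xstar_b₀ : xstar w b₀ = decide (GateFn.numOnes w % 3 = 0) := by
  simp only [xstar, ofNV, b₀, Equiv.symm_apply_apply]
  exact nsolve_single_origin_last w

/-- GapDial helper `toNV_sgl_a₀` (lens-3 g9 GapDial THEOREMS package; see the enclosing section docstring). -/
theorem toNV_sgl_a₀ : toNV (sgl (a₀ : Fin (kk m))) = single (((0 : Fin (m + 1)), (0 : Fin 3)) : Nd m) := by
  funext r s
  simp only [toNV, sgl, a₀, single, EmbeddingLike.apply_eq_iff_eq]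

/-- and which is the UNIQUE solution of `N_w x″ = e_{a₀}`. -/
theorem mv_QQ_eq_sgl_iff (x₂ : Fin (kk m) → Bool) : mv (QQ w) x₂ = sgl a₀ ↔ x₂ = xstar w := by
  rw [mv_QQ]
  constructor
  · intro h
    have h2 : nmul w (toNV x₂) = toNV (sgl a₀) := by rw [← toNV_ofNV (nmul w (toNV x₂)), h]
    rw [toNV_sgl_a₀] at h2
    have h3 : toNV x₂ = nsolve w (single (((0 : Fin (m + 1)), (0 : Fin 3)) : Nd m)) :=
      nmul_injective w (by rw [h2, nmul_nsolve])
    rw [xstar, ← h3, ofNV_toNV]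
  · rintro rfl
    rw [xstar, toNV_ofNV, nmul_nsolve, ← toNV_sgl_a₀, ofNV_toNV]

/-! ### The generic FEEDBACK PAIR at size `K`: cross matrix `M`, readout `b`, source `a` -/

section Feedback

variable {K : ℕ}

/-- ★ `F = ⟨x′, M x″⟩ ⊕ x″_b` (quadratic), -/
def FF (K : ℕ) (M : Fin K → Fin K → Bool) (b : Fin K) : CubicForm (K + K) := blTable K false (fun _ => false) M (sgl b)

/-- ★ `G = 1 ⊕ ⟨y′,y″⟩ ⊕ y″_a` (quadratic; does not depend on `M`). -/
def GG (K : ℕ) (a : Fin K) : CubicForm (K + K) := blTable K true (fun _ => false) dM (sgl a)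

/-- GapDial helper `eval_FF` (lens-3 g9 GapDial THEOREMS package; see the enclosing section docstring). -/
theorem eval_FF (M : Fin K → Fin K → Bool) (b : Fin K) (x₁ x₂ : Fin K → Bool) :
    (FF K M b).eval (Fin.append x₁ x₂) = xor (bd x₁ (mv M x₂)) (x₂ b) := by
  rw [FF, eval_blTable, bd_zero_left, bd_sgl_left, Bool.false_xor, Bool.false_xor]

/-- GapDial helper `eval_GG` (lens-3 g9 GapDial THEOREMS package; see the enclosing section docstring). -/
theorem eval_GG (a : Fin K) (y₁ y₂ : Fin K → Bool) : (GG K a).eval (Fin.append y₁ y₂) = xor (xor true (bd y₁ y₂)) (y₂ a) := by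
  rw [GG, eval_blTable, bd_zero_left, bd_sgl_left, mv_dM, Bool.xor_false]

/-- ★★ THE FEEDBACK CHARACTER SUM: `Σ_{x,y} (-1)^{F(x) + x·y + G(y)} = -2^{2K} Σ_{x″ : (I+M)x″ = e_a} (-1)^{x″_b}` — the `x′`-sum forces
`y′ = M x″`, the `y″`-sum then forces `x″ ⊕ y′ = e_a`. -/
theorem fsum_feedback (M : Fin K → Fin K → Bool) (a b : Fin K) :
    ∑ x : Fin (K + K) → Bool, ∑ y : Fin (K + K) → Bool, signOf ((FF K M b).eval x) * twist x y * signOf ((GG K a).eval y)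
      = -((2 : ℝ) ^ K * (2 : ℝ) ^ K) * ∑ x₂ : Fin K → Bool, (if bxor x₂ (mv M x₂) = sgl a then signOf (x₂ b) else 0) := by
  have hy : ∀ x : Fin (K + K) → Bool,
      ∑ y : Fin (K + K) → Bool, signOf ((FF K M b).eval x) * twist x y * signOf ((GG K a).eval y)
        = ∑ y₁ : Fin K → Bool, ∑ y₂ : Fin K → Bool,
            signOf ((FF K M b).eval x) * twist x (Fin.append y₁ y₂) * signOf ((GG K a).eval (Fin.append y₁ y₂)) :=
    fun x => sum_append _
  simp_rw [hy]
  rw [sum_append]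
  simp_rw [eval_FF, eval_GG, twist_append, signOf_xor, signOf_bd, SgnForrMem.signOf_true]
  -- (A) the innermost `y₂`-sum: `Σ_{y₂} (-1)^{⟨x₂ ⊕ y₁ ⊕ e_a, y₂⟩} = 2^K [y₁ = x₂ ⊕ e_a]`
  have hA : ∀ x₁ x₂ y₁ : Fin K → Bool,
      ∑ y₂ : Fin K → Bool, twist x₁ (mv M x₂) * signOf (x₂ b) * (twist x₁ y₁ * twist x₂ y₂) * (-1 * twist y₁ y₂ * signOf (y₂ a))
        = (twist x₁ (mv M x₂) * signOf (x₂ b) * twist x₁ y₁ * -1) * (if y₁ = bxor x₂ (sgl a) then (2 : ℝ) ^ K else 0) := by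
    intro x₁ x₂ y₁
    have e : ∀ y₂ : Fin K → Bool,
        twist x₁ (mv M x₂) * signOf (x₂ b) * (twist x₁ y₁ * twist x₂ y₂) * (-1 * twist y₁ y₂ * signOf (y₂ a))
          = (twist x₁ (mv M x₂) * signOf (x₂ b) * twist x₁ y₁ * -1) * twist y₂ (bxor (bxor x₂ y₁) (sgl a)) := by
      intro y₂
      rw [signOf_apply_eq_twist_sgl a y₂, twist_comm y₂ (bxor (bxor x₂ y₁) (sgl a)), DerivativeWalsh.twist_bxor_left,
        DerivativeWalsh.twist_bxor_left]
      ring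
    simp_rw [e]
    rw [← mul_sum, BuzetChailloux.sum_twist_left]
    simp only [BuzetChailloux.bxor_eq_zeroVec_iff, bxor_left_eq_iff' x₂ y₁ (sgl a)]
  simp_rw [hA, mul_ite, mul_zero, Finset.sum_ite_eq', Finset.mem_univ, if_true]
  -- (B) swap, then the `x₁`-sum: `Σ_{x₁} (-1)^{⟨x₁, M x₂ ⊕ x₂ ⊕ e_a⟩} = 2^K [(I+M) x₂ = e_a]`
  rw [sum_comm]
  have hB : ∀ x₂ : Fin K → Bool,
      ∑ x₁ : Fin K → Bool, twist x₁ (mv M x₂) * signOf (x₂ b) * twist x₁ (bxor x₂ (sgl a)) * -1 * (2 : ℝ) ^ K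
        = (signOf (x₂ b) * -1 * (2 : ℝ) ^ K) * (if bxor x₂ (mv M x₂) = sgl a then (2 : ℝ) ^ K else 0) := by
    intro x₂
    have e : ∀ x₁ : Fin K → Bool,
        twist x₁ (mv M x₂) * signOf (x₂ b) * twist x₁ (bxor x₂ (sgl a)) * -1 * (2 : ℝ) ^ K
          = (signOf (x₂ b) * -1 * (2 : ℝ) ^ K) * twist x₁ (bxor (mv M x₂) (bxor x₂ (sgl a))) := by
      intro x₁; simp only [BuzetChailloux.twist_bxor_right]; ring
    simp_rw [e]
    rw [← mul_sum, BuzetChailloux.sum_twist_left]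
    simp only [BuzetChailloux.bxor_eq_zeroVec_iff, ← bxor_left_eq_iff' x₂ (mv M x₂) (sgl a)]
  simp_rw [hB]
  rw [mul_sum]
  refine sum_congr rfl fun x₂ _ => ?_
  split_ifs <;> ring

/-- hence THE VALUE of a feedback pair: `Φ = -2^{-K} Σ_{x″ : (I+M)x″ = e_a} (-1)^{x″_b}`. -/
theorem value_feedback (M : Fin K → Fin K → Bool) (a b : Fin K) :
    (⟨K + K, FF K M b, GG K a⟩ : CubicANFPair).value
      = -((2 : ℝ) ^ K)⁻¹ * ∑ x₂ : Fin K → Bool, (if bxor x₂ (mv M x₂) = sgl a then signOf (x₂ b) else 0) := by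
  show forrelation (FF K M b).eval (GG K a).eval = _
  rw [forrelation, fsum_feedback, DerivativeWalsh.sqrt_two_pow_three_mul, SgnForrMem.sqrt_two_pow_add_self, pow_add]
  have h2 : (2 : ℝ) ^ K ≠ 0 := pow_ne_zero _ two_ne_zero
  field_simp

end Feedback

/-! ### The `MOD₃` instance: `M = E_w` (so `I + M = N_w` is invertible; unique solution = the counter run) -/

/-- ★ the planted instance `(F_w, G)` on `n = 2k`, `k = 3(m+1)` variables. -/
def qinst : CubicANFPair := ⟨kk m + kk m, FF (kk m) (EE w) b₀, GG (kk m) a₀⟩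

/-- GapDial helper `sum_solutions_EE` (lens-3 g9 GapDial THEOREMS package; see the enclosing section docstring). -/
theorem sum_solutions_EE :
    ∑ x₂ : Fin (kk m) → Bool, (if bxor x₂ (mv (EE w) x₂) = sgl a₀ then signOf (x₂ b₀) else 0)
      = signOf (decide (GateFn.numOnes w % 3 = 0)) := by
  simp_rw [bxor_mv_EE, mv_QQ_eq_sgl_iff]
  rw [Finset.sum_ite_eq', if_pos (mem_univ _), xstar_b₀]

/-- ★★ THE VALUE of the planted pair: `Φ(F_w, G) = -2^{-k}·(-1)^{[MOD₃(w)=0]}`. -/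
theorem value_qinst : (qinst w).value = -((2 : ℝ) ^ kk m)⁻¹ * signOf (decide (GateFn.numOnes w % 3 = 0)) := by
  rw [qinst, value_feedback, sum_solutions_EE]

/-- GapDial helper `value_qinst_of_mod` (lens-3 g9 GapDial THEOREMS package; see the enclosing section docstring). -/
theorem value_qinst_of_mod (h : GateFn.numOnes w % 3 = 0) : (qinst w).value = ((2 : ℝ) ^ kk m)⁻¹ := by
  rw [value_qinst, decide_eq_true h, SgnForrMem.signOf_true]; ring

/-- GapDial helper `value_qinst_of_not_mod` (lens-3 g9 GapDial THEOREMS package; see the enclosing section docstring). -/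
theorem value_qinst_of_not_mod (h : ¬ GateFn.numOnes w % 3 = 0) : (qinst w).value = -((2 : ℝ) ^ kk m)⁻¹ := by
  rw [value_qinst, decide_eq_false h]; simp [signOf]

/-- GapDial helper `qinst_even` (lens-3 g9 GapDial THEOREMS package; see the enclosing section docstring). -/
theorem qinst_even : Even (qinst w).n := ⟨kk m, rfl⟩

/-- the planted instances sit in the gap slice as soon as `δ(2k) ≤ 2^{-k}`: YES iff `MOD₃(w) = 0`, -/
theorem qinst_mem_yes {δ : ℕ → ℝ} (hδ : δ (kk m + kk m) ≤ ((2 : ℝ) ^ kk m)⁻¹) (h : GateFn.numOnes w % 3 = 0) :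
    (qinst w).encode ∈ (GapSlice δ).yes :=
  ⟨qinst w, ⟨qinst_even w, by rw [value_qinst_of_mod w h]; exact hδ⟩, rfl⟩

/-- NO otherwise. -/
theorem qinst_mem_no {δ : ℕ → ℝ} (hδ : δ (kk m + kk m) ≤ ((2 : ℝ) ^ kk m)⁻¹) (h : ¬ GateFn.numOnes w % 3 = 0) :
    (qinst w).encode ∈ (GapSlice δ).no :=
  ⟨qinst w, ⟨qinst_even w, by rw [value_qinst_of_not_mod w h]; exact neg_le_neg hδ⟩, rfl⟩

/-! ### The instance code is a literal projection of `w`, of polynomial length -/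

/-- GapDial helper `isLit_FF_cube` (lens-3 g9 GapDial THEOREMS package; see the enclosing section docstring). -/
theorem isLit_FF_cube {K : ℕ} (M : (Fin m → Bool) → Fin K → Fin K → Bool) (hM : ∀ a b, IsLit fun w => M w a b) (b : Fin K)
    (i j l : Fin (K + K)) : IsLit fun w : Fin m → Bool => (FF K (M w) b).cube i j l := by
  unfold FF blTable
  refine IsLit.const_and _ ?_
  generalize finSumFinEquiv.symm i = u
  generalize finSumFinEquiv.symm l = v
  rcases u with a | c <;> rcases v with a' | c'
  · exact IsLit.const _
  · exact hM _ _
  · exact IsLit.const _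
  · exact IsLit.const _

/-- GapDial helper `isLit_EE` (lens-3 g9 GapDial THEOREMS package; see the enclosing section docstring). -/
theorem isLit_EE (a b : Fin (kk m)) : IsLit fun w : Fin m → Bool => EE w a b := isLit_edgeB _ _

/-- ★ `w ↦ code(qinst w)` IS A LITERAL PROJECTION (the second table does not even depend on `w`). -/
theorem isProj_encode_qinst : IsProj fun w : Fin m → Bool => (qinst w).encode := by
  unfold CubicANFPair.encode
  exact (IsProj.const (encodeNat (kk m + kk m))).boolPair
    ((isProj_encode_form (fun w => FF (kk m) (EE w) b₀) false (fun _ => rfl) (isLit_FF_cube (fun w => EE w) isLit_EE b₀)).boolPair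
      (isProj_encode_form (fun _ => GG (kk m) a₀) true (fun _ => rfl) fun _ _ _ => IsLit.const _))

/-- GapDial helper `length_encode_qinst_le` (lens-3 g9 GapDial THEOREMS package; see the enclosing section docstring). -/
theorem length_encode_qinst_le : (qinst w).encode.length ≤ uPoly.eval m := by
  rw [uPoly_eval]
  refine (length_encode_pair_le _).trans (le_of_eq ?_)
  show lenB (kk m + kk m) = _
  congr 1; simp only [kk]; ring

/-- ★★ THE PLANTING THEOREM (any prime `p ≠ 3`, by Smolensky `MOD₃ ∉ AC⁰[p]`): every gap function with `δ(2k) ≤ 2^{-k}` along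
the planted arities `2k = 6(m+1)` gives a rung that HOLDS against non-uniform `AC⁰[p]`. -/
theorem gapSlice_not_mem_AC0Mod_of_small {p : ℕ} (hp : p.Prime) (hp3 : p ≠ 3) {δ : ℕ → ℝ}
    (hδ : ∀ m : ℕ, δ (kk m + kk m) ≤ ((2 : ℝ) ^ kk m)⁻¹) : GapSlice δ ∉ promiseLift (AC0Mod p) :=
  not_promiseLift_AC0Mod_of_proj hp Nat.prime_three hp3 (GapSlice δ) (fun _ w => (qinst w).encode)
    (fun _ => isProj_encode_qinst) uPoly (fun _ w => length_encode_qinst_le w)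
    (fun m w h => qinst_mem_yes w (hδ m) h) (fun m w h => qinst_mem_no w (hδ m) h)

/-- the characteristic-`2` case (the blocker's class). -/
theorem gapSlice_not_mem_of_small {δ : ℕ → ℝ} (hδ : ∀ m : ℕ, δ (kk m + kk m) ≤ ((2 : ℝ) ^ kk m)⁻¹) :
    GapSlice δ ∉ promiseLift (AC0Mod 2) :=
  gapSlice_not_mem_AC0Mod_of_small Nat.prime_two (by decide) hδ


end Automaton

end Summit.QuantumAdvantage.QuantumAdvantage.Theorems.GapDial

end
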